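/-
COR-CM (cell pub-hodgecm2, stage 2 of the Hodge ladder) — count-neutral KERNEL COMBINATORICS «the quartic-twist law in the intrinsic currency»
(seat prover-pub-hodgecm2-b23-g41-0, binder prover b23, gen 41; claim QUARTIC-TRANSPORT F3, HOME/INBOX.md l.10098).
Theorems only; seat b09's complete law of the quartic twist (`Census/QuarticTwistNoScrew.lean` `quarticTwist_complete_law`, with parts I–XVI
behind it), its coinvariant floor (`Census/CoinvariantFloor.lean`) and parts F1/F2 of this transport (`Census/ClockTypesDictionary.lean`,
`Census/ClockTypesTransport.lean`) are used BY NAME; no `decide`, no certificate, no named fact, no `sorry`; `Interfaces.lean` (C1), every E term,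
B01, `Transposition/*`, `PortJoin/*` untouched.
HONEST FRAMING: `HC_CM` is NOT proved, here or anywhere in the tree; nothing here is a period, a count of record or a headline.
T5: n/a-class (no Prop-valued hypothesis binder beyond the datum equations, `3 ≤ |B|` and the order condition on `B`); checker: self, 2026-08-23.
-/
import Summits.HodgeConjecture.CorCM.Census.ClockTypesTransport
import Summits.HodgeConjecture.CorCM.Census.QuarticTwistNoScrew
import Summits.HodgeConjecture.CorCM.Census.CoinvariantFloor

/-!
# The law of the quartic twist in the intrinsic currency: `μ(G, c) = β − 1 − [∃ t ∈ B, 4 ∣ ord t]`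

Let `G` be a finite group with a QUARTIC DATUM `θ : G ≃ ZMod 4 × B` (`θ (PQ) = θ P + θ Q`, `θ c = (2, 0)`; `B` any finite group with `|B| ≥ 3`),
i.e. `G = ⟨u⟩ × B` with `u` central of order `4` and `c = u²` — the Galois types of the CM fields `k₄·L` (`k₄` cyclic quartic CM, `L` totally real
Galois with group `B`).  Write `β = #Block c` (simple CM isogeny classes split by the field) and `δ_B = [∃ t ∈ B, 4 ∣ ord t]`.

* §1 `card_block_eq_card_orb`: the blocks of `(G, c)` are seat b09's orbits of clock types (`Block c ≃ Orb B` through `typeEquiv`).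
* §2 **THE LAW** (`isLeast_card_gfaces_generate_of_quartic`): the least number of rank-four face relations `S ⊆ gfaceSet G c` whose base changes
  generate the integer Hodge lattice `hodgeSpan` modulo the pairs is EXACTLY **`β − 1 − δ_B`** — seat b09's `quarticTwist_complete_law` carried through
  the transport of F2 in both directions (`exists_gfaces_of_model` for the family, `exists_model_family_of_gfaces` for the floor, which is a floor for
  families of HODGE vectors, in particular of faces); the screw / no-screw / odd-`|B|` forms `…_screw` (`β − 2`), `…_noScrew`, `…_odd` (`β − 1`).
* §3 `fibreTwo_add_two_eq_card_block_of_screw`: in the screw case the count is seat b09's coinvariant fibre, `μ = φ₂ = β − 2`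
  (`Coinvariant.fibreTwo_le_card_of_faces` + `card_block_le_fibreTwo_add_two`).

Part F4 (`CorCM/FaceQuarticTwistGeneration.lean`) is the field form.

## References
* [Pohlmann1968] H. Pohlmann, Algebraic cycles on abelian varieties of complex multiplication type, Ann. of Math. 88 (1968), Thm 1.
* [Milne1999] J. S. Milne, Lefschetz motives and the Tate conjecture, Compositio Math. 117 (1999), Prop. 2.1, p. 54.
-/

namespace Summit.HodgeConjecture.CorCM.Census.ClockTypes

open Finset
open Summit.HodgeConjecture.CorCM.Prior.AllgGroup.RfwfAllgGroup
open Summit.HodgeConjecture.CorCM.Census.BlockParity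
open Summit.HodgeConjecture.CorCM.Census.Coinvariant
open Summit.HodgeConjecture.CorCM.Census.QuarticTwist

noncomputable section

variable {G : Type*} [Group G] [Fintype G] [DecidableEq G] {c : G}
variable {B : Type} [AddGroup B] [Fintype B] [DecidableEq B]
variable (θ : G ≃ ZMod 4 × B)

/-! ## §1 Blocks are orbits of clock types -/

omit [Fintype B] [DecidableEq B] in
/-- The block relation is the orbit relation on labels. [folklore] -/
theorem blockSetoid_iff_orbitRel (hθ : ∀ P Q : G, θ (P * Q) = θ P + θ Q) (hθc : θ c = (2, 0)) (Ψ Ψ' : CMF G c) :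
    (blockSetoid c).r Ψ Ψ' ↔ (orbitRel B).r (lab θ Ψ) (lab θ Ψ') := by
  constructor
  · rintro ⟨Q, rfl⟩
    exact ⟨(-(θ Q).1, (θ Q).2), (lab_rt θ hθ hθc Q Ψ).symm⟩
  · rintro ⟨g, hg⟩
    refine ⟨θ.symm (-g.1, g.2), lab_injective θ hθ hθc ?_⟩
    rw [lab_rt θ hθ hθc, Equiv.apply_symm_apply]
    simpa only [neg_neg, Prod.mk.eta] using hg

omit [DecidableEq B] in
/-- **`β(G, c)` is seat b09's block count of the clock model**: `#Block c = #Orb B`. [folklore] -/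
theorem card_block_eq_card_orb (hθ : ∀ P Q : G, θ (P * Q) = θ P + θ Q) (hθc : θ c = (2, 0)) :
    Fintype.card (Block c) = Fintype.card (Orb B) :=
  Fintype.card_congr (Quotient.congr (typeEquiv θ hθ hθc) fun Ψ Ψ' => blockSetoid_iff_orbitRel θ hθ hθc Ψ Ψ')

/-! ## §2 The law -/

/-- **EXISTENCE**: `β − 1 − δ_B` rank-four face relations whose base changes generate `hodgeSpan` modulo the pairs (seat b09's family, transported).
[folklore] -/
theorem exists_gfaces_generate_of_quartic (hθ : ∀ P Q : G, θ (P * Q) = θ P + θ Q) (hθc : θ c = (2, 0)) (hc2 : c * c = 1)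
    (h3 : 3 ≤ Fintype.card B) :
    ∃ S : Finset (CMF G c →₀ ℤ), (↑S ⊆ gfaceSet G c hc2) ∧
      S.card + 1 + (if ∃ t : B, 4 ∣ addOrderOf t then 1 else 0) ≤ Fintype.card (Block c) ∧
      hodgeSpan c hc2 ≤ Submodule.span ℤ (pairSet c) ⊔ Submodule.span ℤ (translates c S) := by
  obtain ⟨⟨S, hS1, hS, hcard⟩, -⟩ := quarticTwist_complete_law B h3
  obtain ⟨S', hS', hcard', hgen⟩ := exists_gfaces_of_model θ hθ hθc hc2 hS1 hS
  refine ⟨S', hS', ?_, hgen⟩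
  rw [card_block_eq_card_orb θ hθ hθc, ← hcard]
  omega

/-- **FLOOR**: every family `S₀` of integer HODGE vectors whose base changes generate `hodgeSpan` modulo the pairs has `β ≤ |S₀| + 1 + δ_B`
(seat b09's floors `card_orb_le_card_add_two` / `card_orb_le_card_add_one_of_noScrew`, transported). [folklore] -/
theorem card_block_le_card_add_of_quartic (hθ : ∀ P Q : G, θ (P * Q) = θ P + θ Q) (hθc : θ c = (2, 0)) (hc2 : c * c = 1)
    (h3 : 3 ≤ Fintype.card B) (S₀ : Finset (CMF G c →₀ ℤ)) (hS₀ : (S₀ : Set (CMF G c →₀ ℤ)) ⊆ hodgeSpan c hc2)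
    (hS : hodgeSpan c hc2 ≤ Submodule.span ℤ (pairSet c) ⊔ Submodule.span ℤ (translates c S₀)) :
    Fintype.card (Block c) ≤ S₀.card + 1 + (if ∃ t : B, 4 ∣ addOrderOf t then 1 else 0) := by
  obtain ⟨-, hfloor⟩ := quarticTwist_complete_law B h3
  obtain ⟨S, hcard, hSH, hgen⟩ := exists_model_family_of_gfaces θ hθ hθc hc2 hS₀ hS
  have h := hfloor S hSH hgen
  rw [card_block_eq_card_orb θ hθ hθc]
  omega

/-- **THE LAW OF THE QUARTIC TWIST, intrinsic currency**: for every finite group `G` with a quartic datum over `B`, `|B| ≥ 3`, the least number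
of rank-four face relations generating the integer Hodge lattice modulo the pairs with their base changes is EXACTLY
`#Block c − 1 − [∃ t ∈ B, 4 ∣ ord t]`. [folklore] -/
theorem isLeast_card_gfaces_generate_of_quartic (hθ : ∀ P Q : G, θ (P * Q) = θ P + θ Q) (hθc : θ c = (2, 0)) (hc2 : c * c = 1)
    (h3 : 3 ≤ Fintype.card B) :
    IsLeast {m : ℕ | ∃ S : Finset (CMF G c →₀ ℤ), (↑S ⊆ gfaceSet G c hc2) ∧ S.card = m ∧
      hodgeSpan c hc2 ≤ Submodule.span ℤ (pairSet c) ⊔ Submodule.span ℤ (translates c S)}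
      (Fintype.card (Block c) - 1 - (if ∃ t : B, 4 ∣ addOrderOf t then 1 else 0)) := by
  constructor
  · obtain ⟨S, hS, hcard, hgen⟩ := exists_gfaces_generate_of_quartic θ hθ hθc hc2 h3
    have hfloor := card_block_le_card_add_of_quartic θ hθ hθc hc2 h3 S (hS.trans (gfaceSet_subset_hodgeSpan c hc2)) hgen
    exact ⟨S, hS, by omega, hgen⟩
  · rintro m ⟨S, hS, rfl, hgen⟩
    have hfloor := card_block_le_card_add_of_quartic θ hθ hθc hc2 h3 S (hS.trans (gfaceSet_subset_hodgeSpan c hc2)) hgen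
    omega

/-- **Exact family**: `S ⊆ gfaceSet` with `|S| + 1 + δ_B = β` generating. [folklore] -/
theorem exists_gfaces_generate_of_quartic_card_eq (hθ : ∀ P Q : G, θ (P * Q) = θ P + θ Q) (hθc : θ c = (2, 0)) (hc2 : c * c = 1)
    (h3 : 3 ≤ Fintype.card B) :
    ∃ S : Finset (CMF G c →₀ ℤ), (↑S ⊆ gfaceSet G c hc2) ∧
      S.card + 1 + (if ∃ t : B, 4 ∣ addOrderOf t then 1 else 0) = Fintype.card (Block c) ∧
      hodgeSpan c hc2 ≤ Submodule.span ℤ (pairSet c) ⊔ Submodule.span ℤ (translates c S) := by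
  obtain ⟨S, hS, hcard, hgen⟩ := exists_gfaces_generate_of_quartic θ hθ hθc hc2 h3
  have hfloor := card_block_le_card_add_of_quartic θ hθ hθc hc2 h3 S (hS.trans (gfaceSet_subset_hodgeSpan c hc2)) hgen
  exact ⟨S, hS, by omega, hgen⟩

/-- A generating face set exists (no count). [folklore] -/
theorem exists_gfaceSet_subset_of_quartic (hθ : ∀ P Q : G, θ (P * Q) = θ P + θ Q) (hθc : θ c = (2, 0)) (hc2 : c * c = 1)
    (h3 : 3 ≤ Fintype.card B) :
    ∃ S : Finset (CMF G c →₀ ℤ), (↑S ⊆ gfaceSet G c hc2) ∧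
      hodgeSpan c hc2 ≤ Submodule.span ℤ (pairSet c) ⊔ Submodule.span ℤ (translates c S) := by
  obtain ⟨S, hS, -, hgen⟩ := exists_gfaces_generate_of_quartic θ hθ hθc hc2 h3
  exact ⟨S, hS, hgen⟩

/-- **SCREW CASE** (`B` has an element of order divisible by `4`): EXACTLY `β − 2` generating faces. [folklore] -/
theorem isLeast_card_gfaces_generate_of_quartic_screw (hθ : ∀ P Q : G, θ (P * Q) = θ P + θ Q) (hθc : θ c = (2, 0)) (hc2 : c * c = 1)
    (h3 : 3 ≤ Fintype.card B) {t : B} (h4 : 4 ∣ addOrderOf t) :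
    IsLeast {m : ℕ | ∃ S : Finset (CMF G c →₀ ℤ), (↑S ⊆ gfaceSet G c hc2) ∧ S.card = m ∧
      hodgeSpan c hc2 ≤ Submodule.span ℤ (pairSet c) ⊔ Submodule.span ℤ (translates c S)} (Fintype.card (Block c) - 2) := by
  have h := isLeast_card_gfaces_generate_of_quartic θ hθ hθc hc2 h3
  rwa [if_pos ⟨t, h4⟩] at h

/-- **NO-SCREW CASE** (no element of `B` has order divisible by `4`): EXACTLY `β − 1` generating faces. [folklore] -/
theorem isLeast_card_gfaces_generate_of_quartic_noScrew (hθ : ∀ P Q : G, θ (P * Q) = θ P + θ Q) (hθc : θ c = (2, 0)) (hc2 : c * c = 1)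
    (h3 : 3 ≤ Fintype.card B) (h4 : ∀ t : B, ¬ 4 ∣ addOrderOf t) :
    IsLeast {m : ℕ | ∃ S : Finset (CMF G c →₀ ℤ), (↑S ⊆ gfaceSet G c hc2) ∧ S.card = m ∧
      hodgeSpan c hc2 ≤ Submodule.span ℤ (pairSet c) ⊔ Submodule.span ℤ (translates c S)} (Fintype.card (Block c) - 1) := by
  have h := isLeast_card_gfaces_generate_of_quartic θ hθ hθc hc2 h3
  rwa [if_neg (fun ⟨t, ht⟩ => h4 t ht), Nat.sub_zero] at h

omit [DecidableEq B] in
/-- For `|B|` odd no element has order divisible by `4`. [folklore] -/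
theorem not_four_dvd_addOrderOf_of_odd (hodd : Odd (Fintype.card B)) (t : B) : ¬ 4 ∣ addOrderOf t := by
  intro h4
  have h := h4.trans (addOrderOf_dvd_card (x := t))
  obtain ⟨k, hk⟩ := hodd
  omega

/-- **`|B|` ODD** (e.g. `G = ℤ/4 × (ℤ/3)ᵏ`, `ℤ/4 × (ℤ/7 ⋊ ℤ/3)`, the cyclic `ℤ/4m'`, `m'` odd): EXACTLY `β − 1` generating faces. [folklore] -/
theorem isLeast_card_gfaces_generate_of_quartic_odd (hθ : ∀ P Q : G, θ (P * Q) = θ P + θ Q) (hθc : θ c = (2, 0)) (hc2 : c * c = 1)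
    (h3 : 3 ≤ Fintype.card B) (hodd : Odd (Fintype.card B)) :
    IsLeast {m : ℕ | ∃ S : Finset (CMF G c →₀ ℤ), (↑S ⊆ gfaceSet G c hc2) ∧ S.card = m ∧
      hodgeSpan c hc2 ≤ Submodule.span ℤ (pairSet c) ⊔ Submodule.span ℤ (translates c S)} (Fintype.card (Block c) - 1) :=
  isLeast_card_gfaces_generate_of_quartic_noScrew θ hθ hθc hc2 h3 (not_four_dvd_addOrderOf_of_odd hodd)

/-! ## §3 The screw count is the coinvariant fibre -/

/-- **SCREW CASE: `φ₂(G, c) + 2 = β(G, c)`** — the `β − 2` generating faces attain seat b09's coinvariant floor, so `μ = φ₂ = β − 2`. [folklore] -/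
theorem fibreTwo_add_two_eq_card_block_of_screw (hθ : ∀ P Q : G, θ (P * Q) = θ P + θ Q) (hθc : θ c = (2, 0)) (hc2 : c * c = 1)
    (h3 : 3 ≤ Fintype.card B) {t : B} (h4 : 4 ∣ addOrderOf t) : fibreTwo c hc2 + 2 = Fintype.card (Block c) := by
  obtain ⟨S, hS, hcard, hgen⟩ := exists_gfaces_generate_of_quartic_card_eq θ hθ hθc hc2 h3
  rw [if_pos ⟨t, h4⟩] at hcard
  have h1 := fibreTwo_le_card_of_faces c hc2 (mul_comm_of_datum θ hθ hθc) S hS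
    (fun y hy => hgen (gfaceSet_subset_hodgeSpan c hc2 hy))
  have h2 := card_block_le_fibreTwo_add_two c hc2 (c_ne_one θ hθ hθc)
  omega

/-- **`μ = φ₂` in the screw case.** [folklore] -/
theorem isLeast_card_gfaces_generate_fibreTwo_of_screw (hθ : ∀ P Q : G, θ (P * Q) = θ P + θ Q) (hθc : θ c = (2, 0)) (hc2 : c * c = 1)
    (h3 : 3 ≤ Fintype.card B) {t : B} (h4 : 4 ∣ addOrderOf t) :
    IsLeast {m : ℕ | ∃ S : Finset (CMF G c →₀ ℤ), (↑S ⊆ gfaceSet G c hc2) ∧ S.card = m ∧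
      hodgeSpan c hc2 ≤ Submodule.span ℤ (pairSet c) ⊔ Submodule.span ℤ (translates c S)} (fibreTwo c hc2) := by
  have h := isLeast_card_gfaces_generate_of_quartic_screw θ hθ hθc hc2 h3 h4
  have hφ := fibreTwo_add_two_eq_card_block_of_screw θ hθ hθc hc2 h3 h4
  rwa [show Fintype.card (Block c) - 2 = fibreTwo c hc2 by omega] at h

/-- In every case **`φ₂ ≤ β − 1 − δ_B ≤ φ₂ + [¬ screw]`**: the face count is within one of the coinvariant fibre, and equal to it in the screw case.
[folklore] -/
theorem fibreTwo_le_card_block_sub (hθ : ∀ P Q : G, θ (P * Q) = θ P + θ Q) (hθc : θ c = (2, 0)) (hc2 : c * c = 1)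
    (h3 : 3 ≤ Fintype.card B) :
    fibreTwo c hc2 ≤ Fintype.card (Block c) - 1 - (if ∃ t : B, 4 ∣ addOrderOf t then 1 else 0) ∧
      Fintype.card (Block c) ≤ fibreTwo c hc2 + 2 := by
  obtain ⟨⟨S, hS, hcard, hgen⟩, -⟩ := isLeast_card_gfaces_generate_of_quartic θ hθ hθc hc2 h3
  have h1 := fibreTwo_le_card_of_faces c hc2 (mul_comm_of_datum θ hθ hθc) S hS
    (fun y hy => hgen (gfaceSet_subset_hodgeSpan c hc2 hy))
  exact ⟨hcard ▸ h1, card_block_le_fibreTwo_add_two c hc2 (c_ne_one θ hθ hθc)⟩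

end

end Summit.HodgeConjecture.CorCM.Census.ClockTypes
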